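import Literature.RepresentationTheory.VerySimpleLifting
import Literature.RepresentationTheory.PermutationModuleHeart
import Literature.RepresentationTheory.GeneralLinear.MatrixRepBaseChange
import Mathlib.RingTheory.TensorProduct.Free
import HarnessLib

/-!
# A lifting of a very simple module is very simple — base-change form (Zarhin 2002, Remarks 4.2 (v)(a))

Sequel of `VerySimpleLifting` (the matrix form `zarhin2002_remark_4_2_v_a`), discharging its
"TODO(general form)". [cite: Zarhin2002VerySimple, §4 Remarks 4.2 (v)(a)] (held arXiv text
`math/0109014`, p. 10; "Remark 5.2(v)" of the printed Moscow Math. J. version, the locator used by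
[cite: Zarhin2005Clifford, §2 Remarks 2.1 (vii)]):

> "(v) Suppose `F` is a discrete valuation field with valuation ring `O_F`, maximal ideal `m_F` and
> residue field `k = O_F/m_F`. Suppose `V_F` a finite-dimensional `F`-vector space,
> `ρ_F : G → Aut_F(V_F)` a `F`-linear representation of `G`. Suppose `T` is a `G`-stable
> `O_F`-lattice in `V_F` and the corresponding `k[G]`-module `T/m_F T` is isomorphic to `V`.
> Assume that the `G`-module `V` is very simple. Then: (a) The `G`-module `V_F` is also very
> simple. In other words, a lifting of a very simple module is also very simple."

## Formalization (base-change form) and deviations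

* **The data, basis-free.** The `G`-stable `O_F`-lattice `T` is taken as the primary object: a
  finite free `O`-module `T` (`Module.Free O T`, `Module.Finite O T`) with an `O`-linear action
  `ρ_T : Representation O G T`. Then `V_F = F ⊗_O T` with `ρ_F = 1 ⊗ ρ_T` (`baseChangeRep F ρ_T`,
  Mathlib's `Module.End.baseChangeHom` composed with `ρ_T`) — every pair (`V_F`, `G`-stable lattice
  `T` spanning `V_F`) of the printed statement is of this form up to isomorphism — and "the
  corresponding `k[G]`-module `T/m_F T`" is `k ⊗_O T` (`baseChangeRep (O ⧸ 𝔪) ρ_T`).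
* **Generality.** As in `VerySimpleLifting`: `O` any principal ideal domain, `F` a fraction field,
  `𝔪` any maximal ideal (`zarhin2002_remark_4_2_v_a_baseChange`); the printed case of a discrete
  valuation ring is `isVerySimple_baseChangeRep_of_residueField`.
* **Proof.** Choose an `O`-basis `b` of `T` (`Module.finBasis`); the `A`-basis `1 ⊗ b` of `A ⊗_O T`
  (Mathlib `Algebra.TensorProduct.basis`) is an isomorphism of `G`-modules between `A ⊗_O T` and the
  matrix representation `g ↦ Mat_b(ρ_T g)` read in `A` — `toMatrixHomOfBasis b ρ_T` base-changed
  along `algebraMap O A` by the tree's `MonoidHom.mapMatrixHom` (file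
  `GeneralLinear/MatrixRepBaseChange`) — (`baseChangeRepEquiv`, by `LinearMap.toMatrix_baseChange`
  and `LinearMap.toMatrix_mulVec_repr`), for `A = k` and `A = F`; `toFraction F φ` and
  `toResidue 𝔪 φ` ARE `φ.mapMatrixHom (algebraMap O F)` and `φ.mapMatrixHom (O → O/𝔪)` (`rfl`,
  recorded in §0 together with `repOfMatrixHom φ = GeneralLinear.matrixRep φ`), very simplicity is
  invariant under isomorphism (`isVerySimple_congr`, file `PermutationModuleHeart`), and the matrix
  form `zarhin2002_remark_4_2_v_a` applies.
-/

namespace Literature.RepresentationTheory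

open Module TensorProduct

/-! ## §0 Bookkeeping: the vocabulary of `VerySimpleLifting` vs. `GeneralLinear.MatrixRepBaseChange` -/

section Bookkeeping

variable {O : Type*} [CommRing O] {G : Type*} [Group G] {d : ℕ} (φ : G →* Matrix (Fin d) (Fin d) O)

/-- `repOfMatrixHom φ` (file `VerySimpleLifting`) is the tree's `GeneralLinear.matrixRep φ`
(file `GeneralLinear/MatrixRepBaseChange`). [cite: Zarhin2002VerySimple, §4 Definition 4.1] -/
theorem repOfMatrixHom_eq_matrixRep : repOfMatrixHom φ = GeneralLinear.matrixRep φ :=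
  MonoidHom.ext fun g ↦ LinearMap.ext fun v ↦ by
    rw [repOfMatrixHom_apply_apply, GeneralLinear.matrixRep_apply]

/-- `toFraction F φ` is the base change `φ.mapMatrixHom (algebraMap O F)` of the tree's
`GeneralLinear/MatrixRepBaseChange`. [cite: Zarhin2002VerySimple, §4 Remarks 4.2 (v)] -/
theorem toFraction_eq_mapMatrixHom (F : Type*) [Field F] [Algebra O F] :
    toFraction F φ = φ.mapMatrixHom (algebraMap O F) := rfl

/-- `toResidue 𝔪 φ` is the base change `φ.mapMatrixHom (O → O/𝔪)`.
[cite: Zarhin2002VerySimple, §4 Remarks 4.2 (v)] -/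
theorem toResidue_eq_mapMatrixHom (p : Ideal O) :
    toResidue p φ = φ.mapMatrixHom (Ideal.Quotient.mk p) := rfl

end Bookkeeping

/-! ## §1 Base change of a representation on an `O`-module, and its matrix form in a basis -/

section BaseChange

variable {O : Type*} [CommRing O] {G : Type*} [Group G] {T : Type*} [AddCommGroup T] [Module O T]

/-- **The `G`-module `A ⊗_O T`** of an `O`-linear representation `ρ_T : G → Aut_O(T)` and an
`O`-algebra `A`: `g ↦ 1 ⊗ ρ_T(g)` (Mathlib's `Module.End.baseChangeHom` composed with `ρ_T`). For
`A = F ⊇ O_F` this is "`V_F`" with its `G`-stable lattice `T = 1 ⊗ T`; for `A = k = O_F/m_F` it is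
"the corresponding `k[G]`-module `T/m_F T`". [cite: Zarhin2002VerySimple, §4 Remarks 4.2 (v)] -/
noncomputable def baseChangeRep (A : Type*) [CommRing A] [Algebra O A] (ρT : Representation O G T) :
    Representation A G (A ⊗[O] T) :=
  ((Module.End.baseChangeHom O A T : Module.End O T →ₐ[O] Module.End A (A ⊗[O] T)) :
      Module.End O T →* Module.End A (A ⊗[O] T)).comp ρT

/-- Unfolding: `baseChangeRep A ρ_T g = (ρ_T g).baseChange A`.
[cite: Zarhin2002VerySimple, §4 Remarks 4.2 (v)] -/
theorem baseChangeRep_apply (A : Type*) [CommRing A] [Algebra O A] (ρT : Representation O G T)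
    (g : G) : baseChangeRep A ρT g = (ρT g).baseChange A := rfl

/-- On pure tensors: `g · (a ⊗ t) = a ⊗ ρ_T(g) t`. [cite: Zarhin2002VerySimple, §4 Remarks 4.2 (v)] -/
theorem baseChangeRep_apply_tmul (A : Type*) [CommRing A] [Algebra O A] (ρT : Representation O G T)
    (g : G) (a : A) (t : T) : baseChangeRep A ρT g (a ⊗ₜ[O] t) = a ⊗ₜ[O] ρT g t := rfl

variable {d : ℕ} (b : Basis (Fin d) O T) (ρT : Representation O G T)

/-- **The matrix form** of `ρ_T` in an `O`-basis `b` of `T`: `g ↦ Mat_b(ρ_T(g))` (the tree's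
`GeneralLinear.toMatrixHom` is the case of the standard basis of `d → O`).
[cite: Zarhin2002VerySimple, §4 Remarks 4.2 (v)] -/
noncomputable def toMatrixHomOfBasis : G →* Matrix (Fin d) (Fin d) O :=
  ((LinearMap.toMatrixAlgEquiv b : Module.End O T ≃ₐ[O] Matrix (Fin d) (Fin d) O) :
      Module.End O T →* Matrix (Fin d) (Fin d) O).comp ρT

/-- Unfolding: `toMatrixHomOfBasis b ρ_T g = Mat_b(ρ_T g)`.
[cite: Zarhin2002VerySimple, §4 Remarks 4.2 (v)] -/
theorem toMatrixHomOfBasis_apply (g : G) :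
    toMatrixHomOfBasis b ρT g = LinearMap.toMatrix b b (ρT g) := rfl

variable (A : Type*) [CommRing A] [Algebra O A]

/-- **Coordinates**: the `A`-basis `1 ⊗ b` of `A ⊗_O T` (Mathlib `Algebra.TensorProduct.basis`)
identifies the `G`-module `A ⊗_O T` with the matrix representation `g ↦ Mat_b(ρ_T g)` read in `A`
(`Mat_{1⊗b}(1 ⊗ f) = Mat_b(f)` entrywise in `A`: Mathlib `LinearMap.toMatrix_baseChange`).
[cite: Zarhin2002VerySimple, §4 Remarks 4.2 (v)] -/
noncomputable def baseChangeRepEquiv :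
    (baseChangeRep A ρT).Equiv
      (repOfMatrixHom ((toMatrixHomOfBasis b ρT).mapMatrixHom (algebraMap O A))) :=
  Representation.Equiv.mk (Algebra.TensorProduct.basis A b).equivFun fun g ↦ by
    apply LinearMap.ext
    intro x
    change (Algebra.TensorProduct.basis A b).equivFun (baseChangeRep A ρT g x) =
      repOfMatrixHom ((toMatrixHomOfBasis b ρT).mapMatrixHom (algebraMap O A)) g
        ((Algebra.TensorProduct.basis A b).equivFun x)
    rw [repOfMatrixHom_apply_apply, MonoidHom.mapMatrixHom_apply, toMatrixHomOfBasis_apply,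
      Basis.equivFun_apply, Basis.equivFun_apply, baseChangeRep_apply,
      ← LinearMap.toMatrix_baseChange, LinearMap.toMatrix_mulVec_repr]

end BaseChange

section Field

variable {O : Type*} [CommRing O] {G : Type*} [Group G] {T : Type*} [AddCommGroup T] [Module O T]
  {d : ℕ} (b : Basis (Fin d) O T) (ρT : Representation O G T) (K : Type*) [Field K] [Algebra O K]

/-- Over a field `K ⊇ O` (or `K = O/𝔪`), very simplicity of `K ⊗_O T` is very simplicity of the
matrix representation `g ↦ Mat_b(ρ_T g)` read in `K`. [cite: Zarhin2002VerySimple, §4 Remarks 4.2 (v)] -/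
theorem isVerySimple_baseChangeRep_iff :
    IsVerySimple (baseChangeRep K ρT) ↔
      IsVerySimple (repOfMatrixHom ((toMatrixHomOfBasis b ρT).mapMatrixHom (algebraMap O K))) :=
  isVerySimple_congr (baseChangeRepEquiv b ρT K)

end Field

/-! ## §2 Remarks 4.2 (v)(a) for a free lattice `T` with a `G`-action -/

section Lifting

variable {O : Type*} [CommRing O] [IsDomain O] [IsPrincipalIdealRing O]
  {F : Type*} [Field F] [Algebra O F] [IsFractionRing O F] (p : Ideal O) [p.IsMaximal]
  {G : Type*} [Group G] {T : Type*} [AddCommGroup T] [Module O T] [Module.Free O T] [Module.Finite O T]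

/-- **Remarks 4.2 (v)(a), base-change form.** Let `O` be a principal ideal domain with fraction field
`F`, `𝔪` a maximal ideal, `k = O/𝔪`, and `T` a finite free `O`-module with an `O`-linear `G`-action
`ρ_T` — i.e. a `G`-stable `O`-lattice spanning the `F`-vector space `V_F = F ⊗_O T`, with
`ρ_F = 1 ⊗ ρ_T`. If the `G`-module `T/𝔪T = k ⊗_O T` is very simple, then the `G`-module `V_F` is very
simple: "a lifting of a very simple module is also very simple". (Reduction to the matrix form
`zarhin2002_remark_4_2_v_a` of file `VerySimpleLifting` in an `O`-basis of `T`.)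
[cite: Zarhin2002VerySimple, §4 Remarks 4.2 (v)(a)] [cite: Zarhin2005Clifford, §2 Remarks 2.1 (vii)] -/
theorem zarhin2002_remark_4_2_v_a_baseChange (ρT : Representation O G T)
    (h : IsVerySimple (baseChangeRep (O ⧸ p) ρT)) : IsVerySimple (baseChangeRep F ρT) := by
  let b : Basis (Fin (finrank O T)) O T := Module.finBasis O T
  letI : Field (O ⧸ p) := Ideal.Quotient.field p
  have h1 : IsVerySimple (repOfMatrixHom (toResidue p (toMatrixHomOfBasis b ρT))) :=
    (isVerySimple_baseChangeRep_iff b ρT (O ⧸ p)).1 h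
  exact (isVerySimple_baseChangeRep_iff b ρT F).2
    (zarhin2002_remark_4_2_v_a p (toMatrixHomOfBasis b ρT) h1)

end Lifting

section DVR

variable {O : Type*} [CommRing O] [IsDomain O] [IsDiscreteValuationRing O]
  {F : Type*} [Field F] [Algebra O F] [IsFractionRing O F]
  {G : Type*} [Group G] {T : Type*} [AddCommGroup T] [Module O T] [Module.Free O T] [Module.Finite O T]

/-- **Remarks 4.2 (v)(a) as printed, base-change form**: `O_F` a discrete valuation ring with fraction
field `F` and residue field `k = O_F/m_F`; `T` a free `O_F`-lattice of finite rank with a `G`-action;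
if the `G`-module `T/m_F T = k ⊗ T` is very simple then so is `V_F = F ⊗ T`.
[cite: Zarhin2002VerySimple, §4 Remarks 4.2 (v)(a)] [cite: Zarhin2005Clifford, §2 Remarks 2.1 (vii)] -/
theorem isVerySimple_baseChangeRep_of_residueField (ρT : Representation O G T)
    (h : IsVerySimple (baseChangeRep (O ⧸ IsLocalRing.maximalIdeal O) ρT)) :
    IsVerySimple (baseChangeRep F ρT) :=
  zarhin2002_remark_4_2_v_a_baseChange (IsLocalRing.maximalIdeal O) ρT h

end DVR

end Literature.RepresentationTheory
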